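/-
Copyright (c) 2026 the pub-hodgecm-mathlib formalisation cell (harness21).  Prover seat hodgecm-mathlib-K2E4-p13 (g2),
Track B «K2-LIT» ∕ h413, ENGINE E4 — #10♯ last mile, brick (B) ED. 2 `K2E4ArchFramePairSemiregular` (K2E4-p14 (g2) ask 2026-09-04T00:03:26Z).  2026-09-04.
-/
import Summits.HodgeConjecture.HodgeConjecture.Theorems.K2E4ArchFramePairIdentification   -- ★ p855851 (this base, g0): `conj_diagonal_mem_unitaryGroup`, `coe_cmRationalToArch_eq_conj_archDiagTorus`
import HarnessLib

/-!
# K2 · E4 — #10♯ last mile, (B) ED. 2: THE SEMIREGULAR AND FRAME DATA OF `γ₀′ = P · diag(e₁, e₂, e₁) · P⁻¹`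
# (Rogawski 1990 §3.8 Prop. 3.8.1 (a) p. 27, §8.2 p. 118; Platonov–Rapinchuk 1994 §2.3)

Cell `pub/hodgecm-mathlib` (D-0151), HCML Track B, crux H413 = `stmt-HodgeConjecture-24833`; prover seat `hodgecm-mathlib-K2E4-p13` (g2), answering K2E4-p14 (g2)'s
ask of 2026-09-04T00:03:26Z for the #10♯ assembly `Theorems/K2E4ExplicitArchConstantPhaseSigned.lean := ★ p855349 ∘ ★ (C) p855849 ∘ ★ (B) p855851 ∘ ★ (A) p855819`.
THEOREMS ONLY (no `def`, no `instance`, no notation, no `sorry`); lane `--supports stmt-HodgeConjecture-24833 --as helper`.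

WHAT.  ★ (A) `explicitArchSingularTransfer_of_packages_signed` exposes an internal rational diagonal frame `(P, α′)` of `H′` (`c(P)ᵀ H′ P = diag α′`, i.e.
`formCongr (cmConjRingHom L) P H′ = diagonal α′`) and a point `y ∈ U(H′)_∞` with `↑y = σ(P) · t_{α′}(σe₁, σe₂, σe₁) · σ(P)⁻¹`; ★ (C) `signLaw_of_frameExport` consumes ★ p855310's
`section Pair` hypotheses AT A RATIONAL SEMIREGULAR ELEMENT with a PINNED DIAGONAL FRAME.  This file supplies, for ANY rational `γ ∈ U(H′)(L⁺)` whose matrix is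
`P · diag(e₁, e₂, e₁) · P⁻¹` (such a `γ = γ₀′` exists: ★ (B) §1, restated as `exists_rational_coe_eq_conj_diagonal`), exactly those hypotheses, in ★ p855310's binder shapes:
* §1 (frame-free algebra over a field): the transposition matrix `W = W₁₂` of the slots `1, 2` (`W² = 1`, `Wᵀ = W`, `σ(W) = W`, `W · diag(f) · W = diag(f₀, f₂, f₁)`,
  `diag(a, b, a) · W = W · diag(a, a, b)`), `charpoly diag(a, b, a) = (X − a)²(X − b)`, `(diag(a, b, a) − a)(diag(a, b, a) − b) = 0`;
* §2 the SEMIREGULAR DATA of `γ`: (i) `sub_smul_one_mul_sub_smul_one_eq_zero` (`(γ − e₁)(γ − e₂) = 0`), (ii) `not_exists_coe_eq_smul_one` (`γ` non-central, from `e₁ ≠ e₂`),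
  (iii) `charpoly_coe_eq` (`charpoly γ = (X − e₁)²(X − e₂)`, Mathlib `Matrix.charpoly_units_conj` + `Matrix.charpoly_diagonal`);
* §3 the PINNED FRAME `(P′, d) = (P · W, (α′₀, α′₂, α′₁))`: (iv) `cmConjRingHom_frame_eq` (`c(dᵢ) = dᵢ`: `diag α′ = formCongr P H′` is hermitian with `H′`, ★
  `transpose_map_formCongr_cm`), (v) `frame_ne_zero` (`dᵢ ≠ 0`: anisotropy transports, ★ `anisotropic_formCongr_cm`, ★ `Godement.det_ne_zero_of_anisotropic`), (vi)
  `transpose_map_mul_mul_frame_eq_diagonal` (`c(P′)ᵀ H′ P′ = diag d`), (vii) `coe_mul_frame_eq` (`γ · P′ = P′ · diag(e₁, e₁, e₂)`), packaged as **`exists_pinned_frame`**;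
  `prod_sign_re_embedding_frame_eq` records that (C)'s sign `Π_w sgn Re σ_w(d₀d₁)` IS (A)'s `Π_w sgn Re σ_w(α′₀α′₂)` (`rfl`);
* §4 **`eq_cmRationalToArch_of_coe_eq`** — (A)'s `y` IS `γ ⊗ 1` in `U(H′)_∞` (★ (B) §2 `coe_cmRationalToArch_eq_conj_archDiagTorus` at `z = (σe₁, σe₂, σe₁)`, coe-injectivity).
So the assembly is `obtain ⟨P, α′, hP, h₁, h₂, y, s, hy, -, hs, hc⟩ := (A) …; obtain ⟨γ₀′, hγ⟩ := exists_rational_coe_eq_conj_diagonal …;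
obtain ⟨P′, hdσ, hd0, hHP, hγP⟩ := exists_pinned_frame …; rw [eq_cmRationalToArch_of_coe_eq … hy, ★ (B) hPair_eq_cmRationalToArch] at hc; exact (C) … (i) (ii) (iii) … hdσ hd0 hHP hγP μ cinf s hs hc`.
HONEST LABEL: HC_CM is proved only modulo the 7 printed citations (2 remaining named inputs: hLiu418 = stmt-HodgeConjecture-24832, h413 = stmt-HodgeConjecture-24833) until rung 0 closes; this
file is frame bookkeeping (pure `GL₃(L)` algebra over ★ definitions) and pays no socket by itself.

## References
* [Rogawski1990] J. D. Rogawski, *Automorphic Representations of Unitary Groups in Three Variables*, Ann. of Math. Stud. 123 (1990), §3.8 Prop. 3.8.1 (a), (d) pp. 27, 30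
  (the pinned frame of a semiregular element: `W₂(γ₀)` = the `e₁`-plane, `W₁(γ₀)` = the `e₂`-line); §8.2 Prop. 8.2.1 (a) p. 118 (`γ₀ ∼ (e₁, e₁, e₂)`, `γ_H = (e₁·1₂, e₂)`).
* [PlatonovRapinchuk1994] V. Platonov, A. Rapinchuk, *Algebraic Groups and Number Theory* (1994), §2.3 (equivalent hermitian forms have conjugate unitary groups).
* [BorelJacquet1979] A. Borel, H. Jacquet, *Automorphic forms and automorphic representations*, PSPM 33.1 (1979), §4.1 (`γ ↦ γ ⊗ 1`).
-/

set_option autoImplicit false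
set_option linter.dupNamespace false  -- the cell's namespace convention `Summit.HodgeConjecture.HodgeConjecture.Cruxes.H413.<File>` repeats the summit = problem name

noncomputable section

open NumberField NumberField.InfinitePlace NumberField.mixedEmbedding Matrix Polynomial
open Literature.NumberTheory.Automorphic Literature.NumberTheory.Rogawski1990
open Literature.AlgebraicGeometry.ShimuraVarieties (unitaryGroup mem_unitaryGroup_iff hermForm)
open Summit.HodgeConjecture.HodgeConjecture.Cruxes.H413.K2E4ArchFramePairIdentification (det_diagonal_ne_zero_of_complexConj_mul_self conj_diagonal_mem_unitaryGroup
  coe_cmRationalToArch_eq_conj_archDiagTorus)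
open scoped MatrixGroups Classical

namespace Summit.HodgeConjecture.HodgeConjecture.Cruxes.H413.K2E4ArchFramePairSemiregular

/-! ## §1 Frame-free algebra over a field: the transposition matrix `W₁₂` and the diagonal `diag(a, b, a)` -/

section Algebra

variable (K : Type) [Field K]

/-- The transposition matrix `W` of the slots `1, 2` squares to `1`. [cite: Rogawski1990, §3.8 Prop. 3.8.1 (a) p. 27] -/
theorem swapMatrix_mul_swapMatrix : (!![(1 : K), 0, 0; 0, 0, 1; 0, 1, 0] : Matrix (Fin 3) (Fin 3) K) * !![(1 : K), 0, 0; 0, 0, 1; 0, 1, 0] = 1 := by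
  ext i j
  fin_cases i <;> fin_cases j <;> simp [Matrix.mul_apply, Fin.sum_univ_three]

/-- `W` is symmetric. [cite: Rogawski1990, §3.8 Prop. 3.8.1 (a) p. 27] -/
theorem swapMatrix_transpose : (!![(1 : K), 0, 0; 0, 0, 1; 0, 1, 0] : Matrix (Fin 3) (Fin 3) K)ᵀ = !![(1 : K), 0, 0; 0, 0, 1; 0, 1, 0] := by
  ext i j
  fin_cases i <;> fin_cases j <;> simp

/-- `W` has entries `0, 1`, so it is fixed by every ring endomorphism applied entrywise. [cite: Rogawski1990, §3.8 Prop. 3.8.1 (a) p. 27] -/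
theorem swapMatrix_map (φ : K →+* K) : (!![(1 : K), 0, 0; 0, 0, 1; 0, 1, 0] : Matrix (Fin 3) (Fin 3) K).map φ = !![(1 : K), 0, 0; 0, 0, 1; 0, 1, 0] := by
  ext i j
  fin_cases i <;> fin_cases j <;> simp

/-- `W · diag(f) · W = diag(f₀, f₂, f₁)`: conjugating a diagonal matrix by the transposition permutes its entries. [cite: Rogawski1990, §3.8 Prop. 3.8.1 (a) p. 27] -/
theorem swapMatrix_mul_diagonal_mul_swapMatrix (f : Fin 3 → K) :
    (!![(1 : K), 0, 0; 0, 0, 1; 0, 1, 0] : Matrix (Fin 3) (Fin 3) K) * Matrix.diagonal f * !![(1 : K), 0, 0; 0, 0, 1; 0, 1, 0] = Matrix.diagonal ![f 0, f 2, f 1] := by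
  have hd : (Matrix.diagonal f : Matrix (Fin 3) (Fin 3) K) = !![f 0, 0, 0; 0, f 1, 0; 0, 0, f 2] := by
    ext i j
    fin_cases i <;> fin_cases j <;> simp [Matrix.diagonal]
  have hd' : (Matrix.diagonal ![f 0, f 2, f 1] : Matrix (Fin 3) (Fin 3) K) = !![f 0, 0, 0; 0, f 2, 0; 0, 0, f 1] := by
    ext i j
    fin_cases i <;> fin_cases j <;> simp [Matrix.diagonal]
  rw [hd, hd']
  ext i j
  fin_cases i <;> fin_cases j <;> simp [Matrix.mul_apply, Fin.sum_univ_three]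

/-- `diag(a, b, a) · W = W · diag(a, a, b)`: the transposition carries the frame order `(e₁, e₂, e₁)` to the pinned order `(e₁, e₁, e₂)`.
[cite: Rogawski1990, §3.8 Prop. 3.8.1 (a) p. 27; §8.2 p. 118] -/
theorem diagonal_mul_swapMatrix (a b : K) :
    Matrix.diagonal ![a, b, a] * (!![(1 : K), 0, 0; 0, 0, 1; 0, 1, 0] : Matrix (Fin 3) (Fin 3) K) = !![(1 : K), 0, 0; 0, 0, 1; 0, 1, 0] * Matrix.diagonal ![a, a, b] := by
  have h := swapMatrix_mul_diagonal_mul_swapMatrix K ![a, b, a]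
  have h0 : (![a, b, a] : Fin 3 → K) 0 = a := rfl
  have h1 : (![a, b, a] : Fin 3 → K) 1 = b := rfl
  have h2 : (![a, b, a] : Fin 3 → K) 2 = a := rfl
  rw [h0, h1, h2] at h
  calc Matrix.diagonal ![a, b, a] * (!![(1 : K), 0, 0; 0, 0, 1; 0, 1, 0] : Matrix (Fin 3) (Fin 3) K)
      = (!![(1 : K), 0, 0; 0, 0, 1; 0, 1, 0] : Matrix (Fin 3) (Fin 3) K) * !![(1 : K), 0, 0; 0, 0, 1; 0, 1, 0] * Matrix.diagonal ![a, b, a] *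
          !![(1 : K), 0, 0; 0, 0, 1; 0, 1, 0] := by rw [swapMatrix_mul_swapMatrix, Matrix.one_mul]
    _ = !![(1 : K), 0, 0; 0, 0, 1; 0, 1, 0] * (!![(1 : K), 0, 0; 0, 0, 1; 0, 1, 0] * Matrix.diagonal ![a, b, a] * !![(1 : K), 0, 0; 0, 0, 1; 0, 1, 0]) := by
          simp only [Matrix.mul_assoc]
    _ = !![(1 : K), 0, 0; 0, 0, 1; 0, 1, 0] * Matrix.diagonal ![a, a, b] := by rw [h]

/-- `charpoly diag(a, b, a) = (X − a)²(X − b)` (Mathlib `Matrix.charpoly_diagonal`). [cite: Rogawski1990, §3.8 Prop. 3.8.1 (a) p. 27] -/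
theorem charpoly_diagonal_aba (a b : K) : (Matrix.diagonal ![a, b, a]).charpoly = (X - C a) ^ 2 * (X - C b) := by
  rw [Matrix.charpoly_diagonal, Fin.prod_univ_three]
  simp only [Matrix.cons_val_zero, Matrix.cons_val_one, Matrix.cons_val_two, Matrix.head_cons, Matrix.tail_cons]
  ring

/-- `(diag(a, b, a) − a)(diag(a, b, a) − b) = 0`: the diagonal model of a split semiregular element is killed by `(X − a)(X − b)`.
[cite: Rogawski1990, §3.8 Prop. 3.8.1 (a) p. 27] -/
theorem diagonal_sub_smul_one_mul_diagonal_sub_smul_one (a b : K) :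
    (Matrix.diagonal ![a, b, a] - a • (1 : Matrix (Fin 3) (Fin 3) K)) * (Matrix.diagonal ![a, b, a] - b • (1 : Matrix (Fin 3) (Fin 3) K)) = 0 := by
  rw [smul_one_eq_diagonal, smul_one_eq_diagonal, Matrix.diagonal_sub, Matrix.diagonal_sub, Matrix.diagonal_mul_diagonal, ← Matrix.diagonal_zero]
  congr 1
  funext i
  fin_cases i <;> simp

end Algebra

/-! ## §2 The semiregular data of a rational `γ` with matrix `P · diag(e₁, e₂, e₁) · P⁻¹` -/

section Semiregular

variable (L : Type) [Field L] [NumberField L] [IsCMField L] (H' : Matrix (Fin 3) (Fin 3) L) (P : GL (Fin 3) L) {e₁ e₂ : L}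
  (γ : (UnitaryGroup.cmDatum L 3 H').Rational)
  (hγ : (((γ : unitaryGroup (cmConjRingHom L) H').val : GL (Fin 3) L) : Matrix (Fin 3) (Fin 3) L) =
    (P : Matrix (Fin 3) (Fin 3) L) * Matrix.diagonal ![e₁, e₂, e₁] * ((P⁻¹ : GL (Fin 3) L) : Matrix (Fin 3) (Fin 3) L))

/-- **THE RATIONAL ELEMENT `γ₀′` EXISTS**: for a rational diagonal frame `c(P)ᵀ H′ P = diag α′` and unit-circle entries `c(dᵢ) dᵢ = 1` there is `γ ∈ U(H′)(L⁺)` with matrix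
`P · diag(d) · P⁻¹` (★ (B) §1 `conj_diagonal_mem_unitaryGroup`, restated with the matrix as the datum). [cite: Rogawski1990, §3.8 Prop. 3.8.1 (a) p. 27] [cite: PlatonovRapinchuk1994, §2.3] -/
theorem exists_rational_coe_eq_conj_diagonal (α' : Fin 3 → L) (hP : formCongr (cmConjRingHom L) P H' = Matrix.diagonal α')
    (d : Fin 3 → L) (hd : ∀ i, (IsCMField.complexConj L (d i) : L) * d i = 1) :
    ∃ γ' : (UnitaryGroup.cmDatum L 3 H').Rational,
      (((γ' : unitaryGroup (cmConjRingHom L) H').val : GL (Fin 3) L) : Matrix (Fin 3) (Fin 3) L) =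
        (P : Matrix (Fin 3) (Fin 3) L) * Matrix.diagonal d * ((P⁻¹ : GL (Fin 3) L) : Matrix (Fin 3) (Fin 3) L) :=
  ⟨⟨P * Matrix.GeneralLinearGroup.mkOfDetNeZero (Matrix.diagonal d) (det_diagonal_ne_zero_of_complexConj_mul_self L d hd) * P⁻¹,
    conj_diagonal_mem_unitaryGroup L H' P α' hP d hd⟩, rfl⟩

omit [NumberField L] [IsCMField L] in
/-- `P · P⁻¹ = 1` on matrices. [cite: PlatonovRapinchuk1994, §2.3] -/
theorem coe_mul_coe_inv : (P : Matrix (Fin 3) (Fin 3) L) * ((P⁻¹ : GL (Fin 3) L) : Matrix (Fin 3) (Fin 3) L) = 1 := by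
  rw [← Units.val_mul, mul_inv_cancel, Units.val_one]

omit [NumberField L] [IsCMField L] in
/-- `P⁻¹ · P = 1` on matrices. [cite: PlatonovRapinchuk1994, §2.3] -/
theorem coe_inv_mul_coe : ((P⁻¹ : GL (Fin 3) L) : Matrix (Fin 3) (Fin 3) L) * (P : Matrix (Fin 3) (Fin 3) L) = 1 := by
  rw [← Units.val_mul, inv_mul_cancel, Units.val_one]

include hγ in
/-- In the frame, `γ − e·1 = P · (diag(e₁, e₂, e₁) − e·1) · P⁻¹`. [cite: Rogawski1990, §3.8 Prop. 3.8.1 (a) p. 27] -/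
theorem coe_sub_smul_one_eq (e : L) :
    (((γ : unitaryGroup (cmConjRingHom L) H').val : GL (Fin 3) L) : Matrix (Fin 3) (Fin 3) L) - e • (1 : Matrix (Fin 3) (Fin 3) L) =
      (P : Matrix (Fin 3) (Fin 3) L) * (Matrix.diagonal ![e₁, e₂, e₁] - e • (1 : Matrix (Fin 3) (Fin 3) L)) * ((P⁻¹ : GL (Fin 3) L) : Matrix (Fin 3) (Fin 3) L) := by
  rw [hγ, Matrix.mul_sub, Matrix.sub_mul, Matrix.mul_smul, Matrix.mul_one, Matrix.smul_mul, coe_mul_coe_inv]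

include hγ in
/-- **(i) `hsplit′`: `(γ − e₁)(γ − e₂) = 0`** for `γ = P · diag(e₁, e₂, e₁) · P⁻¹` — ★ p855310's binder `hsplit` verbatim. [cite: Rogawski1990, §3.8 Prop. 3.8.1 (a) p. 27; §8.2 p. 118] -/
theorem sub_smul_one_mul_sub_smul_one_eq_zero :
    ((((γ : unitaryGroup (cmConjRingHom L) H').val : GL (Fin 3) L) : Matrix (Fin 3) (Fin 3) L) - e₁ • (1 : Matrix (Fin 3) (Fin 3) L)) *
      ((((γ : unitaryGroup (cmConjRingHom L) H').val : GL (Fin 3) L) : Matrix (Fin 3) (Fin 3) L) - e₂ • (1 : Matrix (Fin 3) (Fin 3) L)) = 0 := by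
  rw [coe_sub_smul_one_eq L H' P γ hγ e₁, coe_sub_smul_one_eq L H' P γ hγ e₂]
  calc (P : Matrix (Fin 3) (Fin 3) L) * (Matrix.diagonal ![e₁, e₂, e₁] - e₁ • (1 : Matrix (Fin 3) (Fin 3) L)) * ((P⁻¹ : GL (Fin 3) L) : Matrix (Fin 3) (Fin 3) L) *
        ((P : Matrix (Fin 3) (Fin 3) L) * (Matrix.diagonal ![e₁, e₂, e₁] - e₂ • (1 : Matrix (Fin 3) (Fin 3) L)) * ((P⁻¹ : GL (Fin 3) L) : Matrix (Fin 3) (Fin 3) L))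
      = (P : Matrix (Fin 3) (Fin 3) L) * ((Matrix.diagonal ![e₁, e₂, e₁] - e₁ • (1 : Matrix (Fin 3) (Fin 3) L)) *
          (((P⁻¹ : GL (Fin 3) L) : Matrix (Fin 3) (Fin 3) L) * (P : Matrix (Fin 3) (Fin 3) L)) * (Matrix.diagonal ![e₁, e₂, e₁] - e₂ • (1 : Matrix (Fin 3) (Fin 3) L))) *
          ((P⁻¹ : GL (Fin 3) L) : Matrix (Fin 3) (Fin 3) L) := by simp only [Matrix.mul_assoc]
    _ = 0 := by rw [coe_inv_mul_coe, Matrix.mul_one, diagonal_sub_smul_one_mul_diagonal_sub_smul_one, Matrix.mul_zero, Matrix.zero_mul]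

include hγ in
/-- **(ii) `hnc′`: `γ` is NOT central** for `γ = P · diag(e₁, e₂, e₁) · P⁻¹` with `e₁ ≠ e₂` (`P⁻¹ (ζ·1) P = ζ·1` would force `e₁ = ζ = e₂`) — ★ p855310's binder `hnc` verbatim.
[cite: Rogawski1990, §3.8 Prop. 3.8.1 (a) p. 27; §8.2 p. 118] -/
theorem not_exists_coe_eq_smul_one (he : e₁ ≠ e₂) :
    ¬ ∃ ζ : L, (((γ : unitaryGroup (cmConjRingHom L) H').val : GL (Fin 3) L) : Matrix (Fin 3) (Fin 3) L) = ζ • (1 : Matrix (Fin 3) (Fin 3) L) := by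
  rintro ⟨ζ, hζ⟩
  have hD : Matrix.diagonal ![e₁, e₂, e₁] = ζ • (1 : Matrix (Fin 3) (Fin 3) L) := by
    calc Matrix.diagonal ![e₁, e₂, e₁]
        = (((P⁻¹ : GL (Fin 3) L) : Matrix (Fin 3) (Fin 3) L) * (P : Matrix (Fin 3) (Fin 3) L)) * Matrix.diagonal ![e₁, e₂, e₁] *
            (((P⁻¹ : GL (Fin 3) L) : Matrix (Fin 3) (Fin 3) L) * (P : Matrix (Fin 3) (Fin 3) L)) := by rw [coe_inv_mul_coe, Matrix.one_mul, Matrix.mul_one]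
      _ = ((P⁻¹ : GL (Fin 3) L) : Matrix (Fin 3) (Fin 3) L) *
            ((P : Matrix (Fin 3) (Fin 3) L) * Matrix.diagonal ![e₁, e₂, e₁] * ((P⁻¹ : GL (Fin 3) L) : Matrix (Fin 3) (Fin 3) L)) * (P : Matrix (Fin 3) (Fin 3) L) := by
          simp only [Matrix.mul_assoc]
      _ = ζ • (1 : Matrix (Fin 3) (Fin 3) L) := by rw [← hγ, hζ, Matrix.mul_smul, Matrix.mul_one, Matrix.smul_mul, coe_inv_mul_coe]
  have h0 := congrFun (congrFun hD 0) 0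
  have h1 := congrFun (congrFun hD 1) 1
  simp only [Matrix.diagonal_apply_eq, Matrix.smul_apply, Matrix.one_apply_eq, smul_eq_mul, mul_one, Matrix.cons_val_zero, Matrix.cons_val_one] at h0 h1
  exact he (h0.trans h1.symm)

include hγ in
/-- **(iii) `hχ′`: `charpoly γ = (X − e₁)²(X − e₂)`** for `γ = P · diag(e₁, e₂, e₁) · P⁻¹` (Mathlib `Matrix.charpoly_units_conj`, `Matrix.charpoly_diagonal`) — ★ p855310's binder `hχ`
verbatim. [cite: Rogawski1990, §3.8 Prop. 3.8.1 (a) p. 27; §14.5 p. 239] -/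
theorem charpoly_coe_eq :
    (((γ : unitaryGroup (cmConjRingHom L) H').val : GL (Fin 3) L) : Matrix (Fin 3) (Fin 3) L).charpoly =
      (Polynomial.X - Polynomial.C e₁) ^ 2 * (Polynomial.X - Polynomial.C e₂) := by
  rw [hγ, Matrix.coe_units_inv, Matrix.charpoly_units_conj, charpoly_diagonal_aba]

end Semiregular

/-! ## §3 The pinned frame `(P′, d) = (P · W, (α′₀, α′₂, α′₁))` of `γ` -/

section Frame

variable (L : Type) [Field L] [NumberField L] [IsCMField L] (H' : Matrix (Fin 3) (Fin 3) L)
  (hherm : (H'.map (cmConjRingHom L)).transpose = H')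
  (hanis : ∀ x : Fin 3 → L, hermForm (cmConjRingHom L) H' x x = 0 → x = 0)
  (P : GL (Fin 3) L) (α' : Fin 3 → L) (hP : formCongr (cmConjRingHom L) P H' = Matrix.diagonal α') {e₁ e₂ : L}
  (γ : (UnitaryGroup.cmDatum L 3 H').Rational)
  (hγ : (((γ : unitaryGroup (cmConjRingHom L) H').val : GL (Fin 3) L) : Matrix (Fin 3) (Fin 3) L) =
    (P : Matrix (Fin 3) (Fin 3) L) * Matrix.diagonal ![e₁, e₂, e₁] * ((P⁻¹ : GL (Fin 3) L) : Matrix (Fin 3) (Fin 3) L))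

include hherm hP in
/-- The frame values are `c`-real: `c(α′ᵢ) = α′ᵢ` (`diag α′ = c(P)ᵀ H′ P` is hermitian with `H′`, ★ `transpose_map_formCongr_cm`). [cite: Rogawski1990, §3.8 Prop. 3.8.1 (d) p. 30] -/
theorem cmConjRingHom_apply_frame_eq (i : Fin 3) : cmConjRingHom L (α' i) = α' i := by
  have h := UnitaryGroup.transpose_map_formCongr_cm L P hherm
  rw [hP] at h
  have hi := congrFun (congrFun h i) i
  rwa [Matrix.transpose_apply, Matrix.map_apply, Matrix.diagonal_apply_eq] at hi

include hanis hP in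
/-- The frame values are non-zero: `α′ᵢ ≠ 0` (anisotropy transports along the frame, ★ `anisotropic_formCongr_cm`; an anisotropic form has non-zero determinant,
★ `Godement.det_ne_zero_of_anisotropic`). [cite: Rogawski1990, §3.8 Prop. 3.8.1 (d) p. 30] -/
theorem frame_apply_ne_zero (i : Fin 3) : α' i ≠ 0 := by
  have h := UnitaryGroup.anisotropic_formCongr_cm L P hanis
  rw [hP] at h
  have hdet := Godement.det_ne_zero_of_anisotropic L (Matrix.diagonal α') h
  rw [Matrix.det_diagonal] at hdet
  exact (Finset.prod_ne_zero_iff.1 hdet) i (Finset.mem_univ i)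

include hherm hP in
/-- **(iv) `hdσ′`: `c(dᵢ) = dᵢ`** for the pinned frame values `d = (α′₀, α′₂, α′₁)` — ★ p855310's binder `hdσ` verbatim. [cite: Rogawski1990, §3.8 Prop. 3.8.1 (d) p. 30] -/
theorem cmConjRingHom_pinnedFrame_eq : ∀ i : Fin 3, cmConjRingHom L (![α' 0, α' 2, α' 1] i) = ![α' 0, α' 2, α' 1] i := by
  intro i
  fin_cases i
  · exact cmConjRingHom_apply_frame_eq L H' hherm P α' hP 0
  · exact cmConjRingHom_apply_frame_eq L H' hherm P α' hP 2
  · exact cmConjRingHom_apply_frame_eq L H' hherm P α' hP 1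

include hanis hP in
/-- **(v) `hd0′`: `dᵢ ≠ 0`** for the pinned frame values `d = (α′₀, α′₂, α′₁)` — ★ p855310's binder `hd0` verbatim. [cite: Rogawski1990, §3.8 Prop. 3.8.1 (d) p. 30] -/
theorem pinnedFrame_ne_zero : ∀ i : Fin 3, ![α' 0, α' 2, α' 1] i ≠ 0 := by
  intro i
  fin_cases i
  · exact frame_apply_ne_zero L H' hanis P α' hP 0
  · exact frame_apply_ne_zero L H' hanis P α' hP 2
  · exact frame_apply_ne_zero L H' hanis P α' hP 1

include hP in
/-- **(vi) `hHP′`: `c(P′)ᵀ H′ P′ = diag(α′₀, α′₂, α′₁)`** for the permuted frame `P′ = P · W` (`c(W) = W = Wᵀ`, `W · diag α′ · W = diag(α′₀, α′₂, α′₁)`) — ★ p855310's binder `hHP`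
verbatim. [cite: Rogawski1990, §3.8 Prop. 3.8.1 (a) p. 27] [cite: PlatonovRapinchuk1994, §2.3] -/
theorem transpose_map_mul_mul_pinnedFrame_eq_diagonal :
    ((((P * ⟨!![(1 : L), 0, 0; 0, 0, 1; 0, 1, 0], !![(1 : L), 0, 0; 0, 0, 1; 0, 1, 0], swapMatrix_mul_swapMatrix L, swapMatrix_mul_swapMatrix L⟩ : GL (Fin 3) L) :
        Matrix (Fin 3) (Fin 3) L)).map (cmConjRingHom L))ᵀ * H' *
        ((P * ⟨!![(1 : L), 0, 0; 0, 0, 1; 0, 1, 0], !![(1 : L), 0, 0; 0, 0, 1; 0, 1, 0], swapMatrix_mul_swapMatrix L, swapMatrix_mul_swapMatrix L⟩ : GL (Fin 3) L) :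
          Matrix (Fin 3) (Fin 3) L) = Matrix.diagonal ![α' 0, α' 2, α' 1] := by
  have hP' : (((P : Matrix (Fin 3) (Fin 3) L)).map (cmConjRingHom L))ᵀ * H' * (P : Matrix (Fin 3) (Fin 3) L) = Matrix.diagonal α' := hP
  rw [Units.val_mul]
  change (((P : Matrix (Fin 3) (Fin 3) L) * !![(1 : L), 0, 0; 0, 0, 1; 0, 1, 0]).map (cmConjRingHom L))ᵀ * H' * ((P : Matrix (Fin 3) (Fin 3) L) * !![(1 : L), 0, 0; 0, 0, 1; 0, 1, 0]) = _
  rw [Matrix.map_mul, swapMatrix_map, Matrix.transpose_mul, swapMatrix_transpose]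
  calc (!![(1 : L), 0, 0; 0, 0, 1; 0, 1, 0] : Matrix (Fin 3) (Fin 3) L) * (((P : Matrix (Fin 3) (Fin 3) L)).map (cmConjRingHom L))ᵀ * H' * ((P : Matrix (Fin 3) (Fin 3) L) * !![(1 : L), 0, 0; 0, 0, 1; 0, 1, 0])
      = !![(1 : L), 0, 0; 0, 0, 1; 0, 1, 0] * ((((P : Matrix (Fin 3) (Fin 3) L)).map (cmConjRingHom L))ᵀ * H' * (P : Matrix (Fin 3) (Fin 3) L)) * !![(1 : L), 0, 0; 0, 0, 1; 0, 1, 0] := by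
          simp only [Matrix.mul_assoc]
    _ = Matrix.diagonal ![α' 0, α' 2, α' 1] := by rw [hP', swapMatrix_mul_diagonal_mul_swapMatrix]

include hγ in
/-- **(vii) `hγP′`: `γ · P′ = P′ · diag(e₁, e₁, e₂)`** for `γ = P · diag(e₁, e₂, e₁) · P⁻¹` and `P′ = P · W` (`diag(e₁, e₂, e₁) · W = W · diag(e₁, e₁, e₂)`) — ★ p855310's binder `hγP`
verbatim: the first two columns of `P′` span the `e₁`-eigenplane `W₂(γ)`, the third the `e₂`-eigenline `W₁(γ)`. [cite: Rogawski1990, §3.8 Prop. 3.8.1 (a) p. 27; §8.2 p. 118] -/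
theorem coe_mul_pinnedFrame_eq :
    ((((γ : unitaryGroup (cmConjRingHom L) H').val : GL (Fin 3) L) : Matrix (Fin 3) (Fin 3) L)) *
        ((P * ⟨!![(1 : L), 0, 0; 0, 0, 1; 0, 1, 0], !![(1 : L), 0, 0; 0, 0, 1; 0, 1, 0], swapMatrix_mul_swapMatrix L, swapMatrix_mul_swapMatrix L⟩ : GL (Fin 3) L) :
          Matrix (Fin 3) (Fin 3) L) =
      ((P * ⟨!![(1 : L), 0, 0; 0, 0, 1; 0, 1, 0], !![(1 : L), 0, 0; 0, 0, 1; 0, 1, 0], swapMatrix_mul_swapMatrix L, swapMatrix_mul_swapMatrix L⟩ : GL (Fin 3) L) :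
          Matrix (Fin 3) (Fin 3) L) * Matrix.diagonal ![e₁, e₁, e₂] := by
  rw [hγ, Units.val_mul]
  change (P : Matrix (Fin 3) (Fin 3) L) * Matrix.diagonal ![e₁, e₂, e₁] * ((P⁻¹ : GL (Fin 3) L) : Matrix (Fin 3) (Fin 3) L) * ((P : Matrix (Fin 3) (Fin 3) L) * !![(1 : L), 0, 0; 0, 0, 1; 0, 1, 0]) =
    (P : Matrix (Fin 3) (Fin 3) L) * !![(1 : L), 0, 0; 0, 0, 1; 0, 1, 0] * Matrix.diagonal ![e₁, e₁, e₂]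
  calc (P : Matrix (Fin 3) (Fin 3) L) * Matrix.diagonal ![e₁, e₂, e₁] * ((P⁻¹ : GL (Fin 3) L) : Matrix (Fin 3) (Fin 3) L) * ((P : Matrix (Fin 3) (Fin 3) L) * !![(1 : L), 0, 0; 0, 0, 1; 0, 1, 0])
      = (P : Matrix (Fin 3) (Fin 3) L) * (Matrix.diagonal ![e₁, e₂, e₁] * (((P⁻¹ : GL (Fin 3) L) : Matrix (Fin 3) (Fin 3) L) * (P : Matrix (Fin 3) (Fin 3) L)) *
          !![(1 : L), 0, 0; 0, 0, 1; 0, 1, 0]) := by simp only [Matrix.mul_assoc]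
    _ = (P : Matrix (Fin 3) (Fin 3) L) * !![(1 : L), 0, 0; 0, 0, 1; 0, 1, 0] * Matrix.diagonal ![e₁, e₁, e₂] := by
          rw [coe_inv_mul_coe, Matrix.mul_one, diagonal_mul_swapMatrix, Matrix.mul_assoc]

include hherm hanis hP hγ in
/-- **THE PINNED FRAME OF `γ₀′`, PACKAGED**: for `γ = P · diag(e₁, e₂, e₁) · P⁻¹` over the rational diagonal frame `(P, α′)` of the hermitian anisotropic `H′` there is `P′ ∈ GL₃(L)`
with `c(dᵢ) = dᵢ ≠ 0`, `c(P′)ᵀ H′ P′ = diag d`, `γ · P′ = P′ · diag(e₁, e₁, e₂)` for `d = (α′₀, α′₂, α′₁)` — the four frame binders `hdσ hd0 hHP hγP` of ★ p855310 ∕ ★ (C)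
`signLaw_of_frameExport`, with `d₀ d₁ = α′₀ α′₂` ((A)'s sign product). [cite: Rogawski1990, §3.8 Prop. 3.8.1 (a), (d) pp. 27, 30; §8.2 p. 118] [cite: PlatonovRapinchuk1994, §2.3] -/
theorem exists_pinnedFrame :
    ∃ P' : GL (Fin 3) L,
      (∀ i : Fin 3, cmConjRingHom L (![α' 0, α' 2, α' 1] i) = ![α' 0, α' 2, α' 1] i) ∧ (∀ i : Fin 3, ![α' 0, α' 2, α' 1] i ≠ 0) ∧
      (((P' : Matrix (Fin 3) (Fin 3) L)).map (cmConjRingHom L))ᵀ * H' * (P' : Matrix (Fin 3) (Fin 3) L) = Matrix.diagonal ![α' 0, α' 2, α' 1] ∧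
      ((((γ : unitaryGroup (cmConjRingHom L) H').val : GL (Fin 3) L) : Matrix (Fin 3) (Fin 3) L)) * (P' : Matrix (Fin 3) (Fin 3) L) =
        (P' : Matrix (Fin 3) (Fin 3) L) * Matrix.diagonal ![e₁, e₁, e₂] := by
  refine ⟨_, cmConjRingHom_pinnedFrame_eq L H' hherm P α' hP, pinnedFrame_ne_zero L H' hanis P α' hP,
    transpose_map_mul_mul_pinnedFrame_eq_diagonal L H' P α' hP, ?_⟩
  exact coe_mul_pinnedFrame_eq L H' P γ hγ

omit [IsCMField L] in
/-- The pinned frame reads (A)'s sign product: `Π_w sgn Re σ_w(d₀ d₁) = Π_w sgn Re σ_w(α′₀ α′₂)` for `d = (α′₀, α′₂, α′₁)` (definitional). [cite: Rogawski1990, §8.2 p. 117] -/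
theorem prod_sign_re_embedding_pinnedFrame_eq :
    (∏ W : {w : InfinitePlace L // IsComplex w}, (SignType.sign ((W.1.embedding (![α' 0, α' 2, α' 1] 0 * ![α' 0, α' 2, α' 1] 1)).re) : ℤ)) =
      ∏ W : {w : InfinitePlace L // IsComplex w}, (SignType.sign ((W.1.embedding (α' 0 * α' 2)).re) : ℤ) := rfl

end Frame

/-! ## §4 (A)'s point `y` is `γ₀′ ⊗ 1` -/

section Arch

variable (L : Type) [Field L] [NumberField L] [IsCMField L] (H' : Matrix (Fin 3) (Fin 3) L)
  (P : GL (Fin 3) L) (α' : Fin 3 → L) {e₁ e₂ : L}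
  (γ : (UnitaryGroup.cmDatum L 3 H').Rational)
  (hγ : (((γ : unitaryGroup (cmConjRingHom L) H').val : GL (Fin 3) L) : Matrix (Fin 3) (Fin 3) L) =
    (P : Matrix (Fin 3) (Fin 3) L) * Matrix.diagonal ![e₁, e₂, e₁] * ((P⁻¹ : GL (Fin 3) L) : Matrix (Fin 3) (Fin 3) L))

include hγ in
/-- **`y = γ₀′ ⊗ 1` IN `U(H′)_∞`**: the point `y` of ★ (A)'s export, `↑y = σ(P) · t_{α′}(σe₁, σe₂, σe₁) · σ(P)⁻¹` in `GL₃(L ⊗ ℝ)` (hypothesis `hy`, (A)'s tokens verbatim), IS the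
rational point `γ ⊗ 1` of any `γ ∈ U(H′)(L⁺)` with matrix `P · diag(e₁, e₂, e₁) · P⁻¹` (★ (B) §2 `coe_cmRationalToArch_eq_conj_archDiagTorus` at `z = (σe₁, σe₂, σe₁)`, then
coe-injectivity of `U(H′)_∞ ≤ GL₃(L ⊗ ℝ)`). [cite: BorelJacquet1979, §4.1] [cite: Rogawski1990, §8.2 Prop. 8.2.1 (a) p. 118] -/
theorem eq_cmRationalToArch_of_coe_eq (h₁ : (IsCMField.complexConj L e₁ : L) * e₁ = 1) (h₂ : (IsCMField.complexConj L e₂ : L) * e₂ = 1)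
    (y : UnitaryGroup.arch (↥(maximalRealSubfield L)) L (IsCMField.complexConj L) 3 H')
    (hy : (y : GL (Fin 3) (mixedSpace L)) = Matrix.GeneralLinearGroup.map (mixedEmbedding L) P *
      ((UnitaryGroup.archDiagTorus L 3 α' fun w => ![(⟨w.1.embedding e₁, mem_sphere_zero_iff_norm.mpr (UnitaryGroup.norm_embedding_eq_one_of_complexConj_mul_self L e₁ h₁ w)⟩ : Circle), ⟨w.1.embedding e₂, mem_sphere_zero_iff_norm.mpr (UnitaryGroup.norm_embedding_eq_one_of_complexConj_mul_self L e₂ h₂ w)⟩, ⟨w.1.embedding e₁, mem_sphere_zero_iff_norm.mpr (UnitaryGroup.norm_embedding_eq_one_of_complexConj_mul_self L e₁ h₁ w)⟩] : UnitaryGroup.arch (↥(maximalRealSubfield L)) L (IsCMField.complexConj L) 3 (Matrix.diagonal α')) : GL (Fin 3) (mixedSpace L)) *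
      (Matrix.GeneralLinearGroup.map (mixedEmbedding L) P)⁻¹) :
    y = cmRationalToArch L 3 H' γ := by
  apply Subtype.ext
  rw [hy]
  refine (coe_cmRationalToArch_eq_conj_archDiagTorus L H' P α' ![e₁, e₂, e₁] γ hγ _ ?_).symm
  intro w i
  fin_cases i <;> rfl

end Arch

end Summit.HodgeConjecture.HodgeConjecture.Cruxes.H413.K2E4ArchFramePairSemiregular

end
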